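import Summits.Ventures.DiscreteObjects.Hadamard.ConferenceGraph333CentralizerCards
import Summits.Ventures.DiscreteObjects.Hadamard.ConferenceGraph333OrbitValency

/-!
# The normaliser of an element of order `83` in an automorphism group of srg(333,166,82,83) is a `{2, 83}`-group (kernel)

Framing: lottery ticket; floor = certified bounds/negative ranges.  Cell pub-namedobj (venture DiscreteObjects),
target (H) = `H(668)`, hadamard gen 32.  Sequel to `ConferenceGraph333CentralizerCards` (`|C(ρ₈₃)| ∈ {83, 166}`): for a group `N` of
automorphisms of a hypothetical srg(333,166,82,83) whose elements all NORMALISE `⟨ρ⟩` (`g ρ = ρ^m g` for some `m`), `ρ ∈ N` of order `83`: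
* `normalizing_coprime_commutes` — if `g ρ = ρ^m g`, `g^q = 1` with `q` coprime to `82`, then `g ρ = ρ g` (the induced automorphism of `ℤ/83`
  has order dividing `gcd(q, 82) = 1`; Fermat in `ZMod 83`);
* **`normalizer83_prime_dvd_card`** — every prime divisor of `|N|` is `2` or `83`: an element of order `41` normalising `⟨ρ⟩` is excluded by
  `ConferenceGraph333OrbitValency.no_order41_normalizing_order83`, and an element of prime order `q ∉ {2, 41, 83}` normalising `⟨ρ⟩` commutes with
  `ρ`, giving an element of order `83q` (excluded, `aut_orderOf_of_83_dvd`);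
* **`normalizer83_card_shape`** — hence `|N| = 83 · 2^a` for some `a` (`83² ∤ |N|`).
(On paper the `2`-part is `≤ 4`: the elements acting as `ρ ↦ ρ⁻¹` form a coset of the centraliser, whose `2`-part is `≤ 2`; not formalised here.)
WORDS: structure of a HYPOTHETICAL object; ours (PROVISIONAL; standard group theory).  No `sorry`, no new definitions.
-/

namespace Summit.Ventures.DiscreteObjects.Hadamard

open Finset

section normalizer83
variable {V : Type*} [Fintype V] [DecidableEq V]

omit [Fintype V] [DecidableEq V] in
/-- `g ρ = ρ^m g` implies `g ρ^j = ρ^(m j) g` and `g^k ρ = ρ^(m^k) g^k`. -/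
theorem normalizing_pow_pow (g ρ : Equiv.Perm V) {m : ℕ} (h : g * ρ = ρ ^ m * g) (k : ℕ) :
    g ^ k * ρ = ρ ^ (m ^ k) * g ^ k := by
  have hj : ∀ j : ℕ, g * ρ ^ j = ρ ^ (m * j) * g := by
    intro j
    induction j with
    | zero => simp
    | succ j ih => rw [pow_succ, ← mul_assoc, ih, mul_assoc, h, ← mul_assoc, ← pow_add, Nat.mul_succ]
  induction k with
  | zero => simp
  | succ k ih =>
    rw [pow_succ', mul_assoc, ih, ← mul_assoc, hj, mul_assoc, ← pow_succ']

omit [Fintype V] [DecidableEq V] in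
/-- **An element of order coprime to `82` normalising an element `ρ` of order `83` centralises it.** -/
theorem normalizing_coprime_commutes (g ρ : Equiv.Perm V) (hρo : orderOf ρ = 83) {m q : ℕ} (h : g * ρ = ρ ^ m * g)
    (hgq : g ^ q = 1) (hq : Nat.Coprime q 82) : g * ρ = ρ * g := by
  have hk := normalizing_pow_pow g ρ h q
  rw [hgq, one_mul, mul_one] at hk
  -- m^q ≡ 1 (mod 83)
  have hmod : m ^ q ≡ 1 [MOD 83] := by
    have e : ρ ^ (m ^ q) = ρ ^ 1 := by rw [pow_one]; exact hk.symm
    rw [pow_eq_pow_iff_modEq, hρo] at e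
    exact e
  -- 83 ∤ m
  have hm0 : (m : ZMod 83) ≠ 0 := by
    intro h0
    rw [ZMod.natCast_eq_zero_iff] at h0
    obtain ⟨c, rfl⟩ := h0
    have : ρ ^ (83 * c) = 1 := by rw [pow_mul, ← hρo, pow_orderOf_eq_one, one_pow]
    rw [this, one_mul] at h
    have hρ1 : ρ = 1 := mul_left_cancel (h.trans (mul_one g).symm)
    rw [hρ1, orderOf_one] at hρo
    exact absurd hρo (by norm_num)
  haveI : Fact (Nat.Prime 83) := ⟨by norm_num⟩
  have h1 : (m : ZMod 83) ^ q = 1 := by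
    have := (ZMod.natCast_eq_natCast_iff _ _ _).mpr hmod
    rwa [Nat.cast_pow, Nat.cast_one] at this
  have h2 : (m : ZMod 83) ^ 82 = 1 := ZMod.pow_card_sub_one_eq_one hm0
  have hm1 : (m : ZMod 83) = 1 := (pow_eq_one_iff_of_coprime hq).mp ⟨h1, h2⟩
  have hmod1 : m ≡ 1 [MOD 83] := by
    rw [← ZMod.natCast_eq_natCast_iff, Nat.cast_one]; exact hm1
  have e : ρ ^ m = ρ ^ 1 := by rw [pow_eq_pow_iff_modEq, hρo]; exact hmod1
  rw [h, e, pow_one]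

/-- **Prime divisors of `|N(⟨ρ₈₃⟩)|` are `2` and `83`.**  `N` a group of automorphisms of an `srg(333,166,82,83)` all of whose elements
normalise `⟨ρ⟩`, `ρ ∈ N` of order `83`. -/
theorem normalizer83_prime_dvd_card (hV : Fintype.card V = 333) (A : Matrix V V ℤ)
    (h01 : ∀ x y, A x y = 0 ∨ A x y = 1) (hsymm : ∀ x y, A y x = A x y) (hdiag : ∀ x, A x x = 0)
    (hk : ∀ x, ∑ y, A x y = 166) (hsrg : ∀ x y, ∑ z, A x z * A z y = 83 * (1 + (if x = y then 1 else 0)) - A x y)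
    (N : Subgroup (Equiv.Perm V)) (hN : ∀ g ∈ N, ∀ x y, A (g x) (g y) = A x y)
    (ρ : Equiv.Perm V) (hρ : ρ ^ 83 = 1) (hρ1 : ρ ≠ 1) (hρN : ρ ∈ N) (hnorm : ∀ g ∈ N, ∃ m : ℕ, g * ρ = ρ ^ m * g)
    {q : ℕ} (hq : q.Prime) (hqd : q ∣ Nat.card N) : q = 2 ∨ q = 83 := by
  classical
  haveI := Fact.mk hq
  haveI : Fact (Nat.Prime 83) := ⟨by norm_num⟩
  have hρo : orderOf ρ = 83 := orderOf_eq_prime hρ hρ1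
  have hAρ := hN ρ hρN
  obtain ⟨g, hg⟩ := exists_prime_orderOf_dvd_card' q hqd
  have hg' : orderOf (g : Equiv.Perm V) = q := by rw [Subgroup.orderOf_coe, hg]
  have hgq : (g : Equiv.Perm V) ^ q = 1 := by rw [← hg']; exact pow_orderOf_eq_one _
  have hg1 : (g : Equiv.Perm V) ≠ 1 := by
    intro h; rw [h, orderOf_one] at hg'; exact hq.one_lt.ne hg'
  obtain ⟨m, hm⟩ := hnorm g g.2
  by_cases h41 : q = 41
  · subst h41
    exact (no_order41_normalizing_order83 hV A h01 hsymm hdiag hk hsrg ρ (g : Equiv.Perm V) hρ hρ1 hgq hg1 hAρ (hN g g.2) hm).elim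
  by_cases h2 : q = 2
  · exact Or.inl h2
  by_cases h83 : q = 83
  · exact Or.inr h83
  -- q coprime to 82: g commutes with ρ, so g ρ has order 83 q
  exfalso
  have hcop82 : Nat.Coprime q 82 := by
    rw [show (82 : ℕ) = 2 * 41 by norm_num]
    exact Nat.Coprime.mul_right ((Nat.coprime_primes hq Nat.prime_two).mpr h2)
      ((Nat.coprime_primes hq (by norm_num)).mpr h41)
  have hcomm := normalizing_coprime_commutes (g : Equiv.Perm V) ρ hρo hm hgq hcop82
  have hcop : Nat.Coprime (orderOf (g : Equiv.Perm V)) (orderOf ρ) := by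
    rw [hg', hρo]; exact (Nat.coprime_primes hq (by norm_num)).mpr h83
  have ho : orderOf ((g : Equiv.Perm V) * ρ) = q * 83 := by
    rw [(show Commute (g : Equiv.Perm V) ρ from hcomm).orderOf_mul_eq_mul_orderOf_of_coprime hcop, hg', hρo]
  have hA' : ∀ x y, A (((g : Equiv.Perm V) * ρ) x) (((g : Equiv.Perm V) * ρ) y) = A x y := by
    intro x y; rw [Equiv.Perm.mul_apply, Equiv.Perm.mul_apply, hN g g.2, hAρ]
  rcases aut_orderOf_of_83_dvd hV A h01 hsymm hdiag hk hsrg _ hA' (by rw [ho]; exact Dvd.intro_left q rfl) with h | h <;>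
    rw [ho] at h
  · have : q = 1 := by omega
    exact hq.one_lt.ne' this
  · omega

/-- **`|N(⟨ρ₈₃⟩)| = 83 · 2^a`.** -/
theorem normalizer83_card_shape (hV : Fintype.card V = 333) (A : Matrix V V ℤ)
    (h01 : ∀ x y, A x y = 0 ∨ A x y = 1) (hsymm : ∀ x y, A y x = A x y) (hdiag : ∀ x, A x x = 0)
    (hk : ∀ x, ∑ y, A x y = 166) (hsrg : ∀ x y, ∑ z, A x z * A z y = 83 * (1 + (if x = y then 1 else 0)) - A x y)
    (N : Subgroup (Equiv.Perm V)) (hN : ∀ g ∈ N, ∀ x y, A (g x) (g y) = A x y)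
    (ρ : Equiv.Perm V) (hρ : ρ ^ 83 = 1) (hρ1 : ρ ≠ 1) (hρN : ρ ∈ N) (hnorm : ∀ g ∈ N, ∃ m : ℕ, g * ρ = ρ ^ m * g) :
    ∃ a : ℕ, Nat.card N = 83 * 2 ^ a := by
  haveI : Fact (Nat.Prime 83) := ⟨by norm_num⟩
  have hρo : orderOf ρ = 83 := orderOf_eq_prime hρ hρ1
  have h83 : 83 ∣ Nat.card N := by
    have h := orderOf_dvd_natCard (⟨ρ, hρN⟩ : N)
    rwa [Subgroup.orderOf_mk, hρo] at h
  obtain ⟨-, -, -, hsq⟩ := autGroup_card_not_dvd_23_37_41_83_sq hV A h01 hsymm hdiag hk hsrg N hN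
  obtain ⟨m, hm⟩ := h83
  rcases Nat.eq_two_pow_or_exists_odd_prime_and_dvd m with ⟨a, rfl⟩ | ⟨q, hq, hqm, hqodd⟩
  · exact ⟨a, hm⟩
  · exfalso
    have hq2 : q ≠ 2 := by rintro rfl; exact (Nat.not_even_iff_odd.mpr hqodd) even_two
    have hqN : q ∣ Nat.card N := by rw [hm]; exact Dvd.dvd.mul_left hqm 83
    rcases normalizer83_prime_dvd_card hV A h01 hsymm hdiag hk hsrg N hN ρ hρ hρ1 hρN hnorm hq hqN with h | h
    · exact hq2 h
    · subst h
      exact hsq (by rw [hm, pow_two]; exact Nat.mul_dvd_mul_left 83 hqm)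

end normalizer83

end Summit.Ventures.DiscreteObjects.Hadamard
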